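import Mathlib
import HarnessLib
import Literature.AlgebraicGeometry.HodgeTheory.SemiregularityMapReal
import Literature.AlgebraicGeometry.Modules.ExtCohomologyComparison
import Literature.AlgebraicGeometry.Modules.InvertibleOfRankOne
import Literature.AlgebraicGeometry.Modules.Biduality
import Literature.Algebra.Homology.ExtBiproduct

/-!
# Rank-one finite locally free modules are `0`-semiregular (hence `I`-semiregular for every `I ∋ 0`)

HONEST FRAMING: a HELPER for the crux `KleimanSemiregularAnchor` (K2, stmt-HodgeConjecture-25931, route
`KleimanBFSeeds`, registered stub `stub_good : GoodAnchorPerDiscriminantClass`); it proves NOTHING about K2, rung H2,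
HC_AV, HC_CM or HC. It supplies the first NON-ZERO sheaves for which the tree PROVES the Buchweitz–Flenner
`I`-semiregularity predicate entering `HasBFSheafSeedAt` (`WeilClassesBFSheafSeedAt.lean`): until now only the
zero module was provably `I`-semiregular (census of unit `leafhand-hodge-kleimanbfseeds-1-g0`).

THE THEOREM. For a finite locally free `𝒪_X`-module `L` of (constant) rank one (`Motives.HasRank L 1`) on a scheme
`X`, the sheaf trace `tr : 𝓔nd(L) → 𝒪_X` is an ISOMORPHISM (biduality `Modules.isIso_toBidual` and the rank-one
contraction `Modules.isIso_contract_of_hasRank_one`); hence the trace on `Ext`,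
`Tr : Extⁱ(L, L) → Extⁱ(𝒪_X, 𝒪_X)` (`HodgeTheory.traceExt`), which is Hartshorne's comparison
`Extⁱ(L, L) ≅ Extⁱ(𝒪_X, 𝓔nd L)` (III.6.7, `Modules.extToExtUnitSheafHom_bijective`) followed by `tr`, is
BIJECTIVE, and so is `Tr : Extⁱ(L, L) → Hⁱ(X, 𝒪_X)` (`traceToCohomology`, by III.6.3 (c),
`Modules.extToCohomology_bijective`). In degree `2` this is the component `σ_0` of the Buchweitz–Flenner
semiregularity map: every rank-one `L` is `0`-SEMIREGULAR (`IsZeroSemiregular`, `IsHigherSemiregular · 0`), hence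
`{0,1}`-semiregular, semiregular for the full real map (`IsSemiregularReal`), and `I`-semiregular for every set
of form degrees `I ∋ 0` ("a line bundle is always `0`-semiregular, `σ_0 = tr` being bijective": the trace
`σ_0 : Ext²(F, F) → H²(X, 𝒪_X)` is the map between the obstruction spaces of `F` and of `det F`, an isomorphism for
`F = det F`). For the crux this says: the semiregularity clause of a seed with `1 ∈ I` (so that `0 ∈ {q' | q'+1 ∈ I}`)
is met by every rank-one module — but a rank-one module is never a seed (its `ch₃ = ch₁³/6` lies on the `h`-line
by the exponential field of `ChernCharacterBetti`; dead end «line bundle, I = {3}» of the K2 census), so the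
sheaf K2 needs has rank `≥ 2`.

References: [BuchweitzFlenner2003] §1 (`σ_0`, `k`-semiregular), §4 (trace map), §5 (`I`-semiregular);
[Hartshorne1977] II Ex. 5.1 (a)–(b), III Prop. 6.3 (c), Prop. 6.7; [Mukai1978]/Artamkin (`σ_0 = Tr` and `det`).
-/

-- every declaration of this problem lives in `Summit.HodgeConjecture.HodgeConjecture.…` (summit = sub-problem)
set_option linter.dupNamespace false

noncomputable section

open CategoryTheory CategoryTheory.Abelian AlgebraicGeometry Opposite TopologicalSpace Limits

namespace Summit.HodgeConjecture.HodgeConjecture.Theorems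

open Literature.AlgebraicGeometry.Modules Literature.AlgebraicGeometry.Motives
open Literature.AlgebraicGeometry.HodgeTheory Literature.Algebra.Homology

universe w u

/-! ### §1 The sheaf trace of a rank-one module is an isomorphism -/

section SheafTrace

variable {X : Scheme.{u}} {E : X.Modules}

/-- `𝓔nd(E) → 𝓗om(E, E^∨∨)` (post-composition with biduality) is an isomorphism for `E` finite locally free
(biduality `E ≅ E^∨∨`, Hartshorne II Ex. 5.1 (a), and functoriality of `𝓗om(E, –)`). [cite: Hartshorne1977, II Ex. 5.1 (a)] -/
theorem isIso_endToBidual (hE : IsFiniteLocallyFree E) : IsIso (endToBidual (E := E)) := by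
  haveI := isIso_toBidual E hE
  change IsIso ((sheafHomFunctor E).map (toBidual E (unitModule X)))
  infer_instance

/-- **The trace `tr : 𝓔nd(L) → 𝒪_X` of a rank-one finite locally free `L` is an isomorphism**: biduality followed by
the rank-one contraction `𝓗om(L, 𝓗om(L^∨, 𝒪_X)) ≅ 𝒪_X`. [cite: Hartshorne1977, II Ex. 5.1 (a)–(b)] -/
theorem isIso_trace_of_hasRank_one (hE : IsFiniteLocallyFree E) (h₁ : HasRank E 1) : IsIso (trace hE) := by
  haveI := isIso_endToBidual hE
  haveI := isIso_contract_of_hasRank_one hE (unitModule X) h₁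
  exact IsIso.comp_isIso

end SheafTrace

/-! ### §2 The trace on `Ext` and to cohomology is bijective in rank one -/

section ExtTrace

variable {X : Scheme.{u}} [HasExt.{w} X.Modules] {E : X.Modules} (hE : IsFiniteLocallyFree E)

/-- `Tr = tr ∘ (Extⁱ(E, E) ≅ Extⁱ(𝒪_X, 𝓔nd E))`: the trace on `Ext` is Hartshorne's comparison map
`extToExtUnitSheafHom` (III.6.7) followed by post-composition with the sheaf trace. [cite: Hartshorne1977, III Prop. 6.7]
[cite: BuchweitzFlenner2003, §4 (trace map)] -/
theorem traceExt_eq_extToExtUnitSheafHom_comp (i : ℕ) (x : Ext.{w} E E i) :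
    traceExt hE i x = (extToExtUnitSheafHom hE E i x).comp (Ext.mk₀ (trace hE)) (add_zero i) := by
  rw [traceExt_apply, extToExtUnitSheafHom_apply]
  exact (Ext.comp_assoc_of_third_deg_zero _ _ _ _).symm

/-- **`Tr : Extⁱ(L, L) → Extⁱ(𝒪_X, 𝒪_X)` is bijective for `L` of rank one** (III.6.7 and `tr` an isomorphism).
[cite: Hartshorne1977, III Prop. 6.7] [cite: BuchweitzFlenner2003, §4 (trace map)] -/
theorem traceExt_bijective_of_hasRank_one (h₁ : HasRank E 1) (i : ℕ) :
    Function.Bijective (traceExt hE i) := by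
  haveI := isIso_trace_of_hasRank_one hE h₁
  have h := (Ext.comp_mk₀_hom_bijective (A := unitModule X) (n := i) (asIso (trace hE))).comp
    (extToExtUnitSheafHom_bijective hE E i)
  have hfun : (traceExt hE i : Ext.{w} E E i → Ext.{w} (unitModule X) (unitModule X) i) =
      (fun x : Ext.{w} (unitModule X) (sheafHom E E) i => x.comp (Ext.mk₀ (asIso (trace hE)).hom) (add_zero i)) ∘
        extToExtUnitSheafHom hE E i := by
    funext x
    exact traceExt_eq_extToExtUnitSheafHom_comp hE i x
  rw [hfun]
  exact h

/-- **`Tr : Extⁱ(L, L) → Hⁱ(X, 𝒪_X)` is bijective for `L` of rank one** (add III.6.3 (c):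
`Extⁱ(𝒪_X, 𝒪_X) ≅ Hⁱ(X, 𝒪_X)`). [cite: Hartshorne1977, III Prop. 6.3 (c) and Prop. 6.7] -/
theorem traceToCohomology_bijective_of_hasRank_one (h₁ : HasRank E 1) (i : ℕ) :
    Function.Bijective (traceToCohomology hE i) :=
  (extToCohomology_bijective (unitModule X) i).comp (traceExt_bijective_of_hasRank_one hE h₁ i)

end ExtTrace

/-! ### §3 Rank one ⇒ `0`-semiregular ⇒ `I`-semiregular for every `I ∋ 0` -/

section Sigma

variable {S : Type u} [CommRing S] {X : Over (Spec (CommRingCat.of S))} [HasExt.{w} X.left.Modules]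
  {L : X.left.Modules} (hL : IsFiniteLocallyFree L)

/-- **`σ_0 = Tr : Ext²(L, L) → H²(X, 𝒪_X)` is bijective for `L` of rank one.** [cite: BuchweitzFlenner2003, §1 (σ_0)] -/
theorem sigmaZero_bijective_of_hasRank_one (h₁ : HasRank L 1) : Function.Bijective (sigmaZero.{w} hL) :=
  traceToCohomology_bijective_of_hasRank_one hL h₁ 2

/-- **A rank-one finite locally free module is `0`-semiregular** (`σ_0 = Tr` injective on `Ext²(L, L)`).
[cite: BuchweitzFlenner2003, §1 (k-semiregular)] -/
theorem isZeroSemiregular_of_hasRank_one (h₁ : HasRank L 1) : IsZeroSemiregular.{w} hL :=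
  (sigmaZero_bijective_of_hasRank_one hL h₁).injective

/-- Rank one ⇒ `{0,1}`-semiregular (`(σ_0, σ_1)` injective). [cite: BuchweitzFlenner2003, §5 (I-semiregular)] -/
theorem isZeroOneSemiregular_of_hasRank_one (h₁ : HasRank L 1) : IsZeroOneSemiregular.{w} hL :=
  (isZeroSemiregular_of_hasRank_one hL h₁).isZeroOneSemiregular hL

/-- Rank one ⇒ semiregular for the full real semiregularity map `(σ_q)_q`. [cite: BuchweitzFlenner2003, Def. 4.1] -/
theorem isSemiregularReal_of_hasRank_one (h₁ : HasRank L 1) : IsSemiregularReal.{w} hL :=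
  (isZeroSemiregular_of_hasRank_one hL h₁).isSemiregularReal hL

/-- Rank one ⇒ `0`-semiregular in the uniform family `σ_q` of `SemiregularityHigherSigma` (`IsHigherSemiregular · 0`).
[cite: BuchweitzFlenner2003, §1 (k-semiregular)] -/
theorem isHigherSemiregular_zero_of_hasRank_one (h₁ : HasRank L 1) : IsHigherSemiregular.{w} hL 0 :=
  (isHigherSemiregular_zero_iff hL).2 (isZeroSemiregular_of_hasRank_one hL h₁)

/-- **A rank-one finite locally free module is `I`-semiregular for every set of form degrees `I ∋ 0`** — the
Buchweitz–Flenner predicate `IsISemiregular` of `HasBFSheafSeedAt` holds for non-zero sheaves.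
[cite: BuchweitzFlenner2003, §5 (I-semiregular)] -/
theorem isISemiregular_of_hasRank_one (h₁ : HasRank L 1) {I : Set ℕ} (hI : 0 ∈ I) : IsISemiregular.{w} hL I :=
  IsISemiregular.mono hL (Set.singleton_subset_iff.2 hI)
    ((isHigherSemiregular_iff_isISemiregular_singleton hL 0).1 (isHigherSemiregular_zero_of_hasRank_one hL h₁))

/-- In the seed's indexing: if `1 ∈ I` then a rank-one `L` is `{q' | q' + 1 ∈ I}`-semiregular (the semiregularity
clause of `HasBFSheafSeedAt` with `I ∋ 1`). [cite: BuchweitzFlenner2003, §5 (I-semiregular)] -/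
theorem isISemiregular_pred_of_hasRank_one (h₁ : HasRank L 1) {I : Finset ℕ} (hI : 1 ∈ I) :
    IsISemiregular.{w} hL {q' | q' + 1 ∈ I} :=
  isISemiregular_of_hasRank_one hL h₁ (show 0 + 1 ∈ I from hI)

end Sigma

end Summit.HodgeConjecture.HodgeConjecture.Theorems

end
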